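import Summits.Langlands.Langlands.Theses.SkinnerWilesDefectOne
import Literature.NumberTheory.Automorphic.BianchiSiegelDomainGeometry
import Literature.NumberTheory.Automorphic.BianchiConeTranslates
import Literature.NumberTheory.Automorphic.SiegelTranslateCover
import Literature.NumberTheory.Automorphic.SiegelSetAbsorption
import Literature.NumberTheory.Automorphic.BianchiFundamentalSet
import Literature.NumberTheory.Automorphic.BianchiSiegelFiniteness
import Literature.Algebra.Homology.GroupCohomologyEquivariantGoodCover

/-!
# `BianchiCongruenceCohomologyFinite` (route SkinnerWilesDefectOne, item stmt-Langlands-15362)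

For an imaginary quadratic field `K`, a compact open subgroup `U ≤ GL₂(𝔸_K^∞)`, the congruence
subgroup `Γ_U = GL₂(K) ∩ U` and a FINITE `ℤ[Γ_U]`-module `A`, every `H^q(Γ_U, A)` is finite
([BorelSerre1973, §11.1, Thm. 11.4.4]: arithmetic groups are of type (WFL);
[Serre1971CohomologieGroupesDiscrets, §2.4 Th. 4 (a)]; [Brown1982CohomologyGroups, VIII.9 Ex. 5]).

Proof (line `Sketch` of the crux, reshaped: Čech coresolution along a SIEGEL-TRANSLATE cover).
`Γ_U` acts (through the complex embedding `θ = ImaginaryQuadratic.ratToComplexGL K 2`) on the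
contractible cone `𝒫` of positive definite binary Hermitian forms (`BianchiCone.cone`).  Cover `𝒫`
by the translates `θ(γ) • S(c, τ)` of the Siegel domain `S(c, τ) = 𝔖(c, τ) • 1`
(`BianchiCone.siegelDomain`; relatively open, CONVEX, `siegelDomain_isOpen_convex_eq_image`),
indexed by the free left `Γ_U`-set `ι = {γ ∈ GL₂(K) : γ_f ∈ U · Q}`.  The translates cover the cone
and the nerve has finitely many `Γ_U`-orbits of simplices in each degree
(`SiegelCover.exists_cover_data_of_fundamentalSet_of_siegelProperty`), because of the two halves of
reduction theory, both PROVED in the tree in adelic form and transported to `GL₂(ℂ)`: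
the fundamental set `GL₂(ℂ) = θ(GL₂(K)_Q) · 𝔖(c,τ) · U(2)` (`exists_fundamentalSet_bianchi`, from
`reductionTheory_gl_holds`) and Borel's Siegel property with bounded finite part
(`finite_siegelProperty_bianchi`, from `siegelFiniteness_gl_holds` and the absorption lemma
`exists_isSiegelSetGL_mul_siegelCone_mul_subset`).  Non-empty finite intersections of translates are
contractible (`BianchiCone.isOpen_contractible_translates`), so Leray's theorem makes the Čech
complex of functions on the nerve an exact coresolution of `A` by modules `Fun(N_p, A)` coinduced
from the trivial subgroup over finitely many orbits; Shapiro and Brown's dimension shifting give the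
finiteness (`finite_groupCohomology_int_of_free_equivariantGoodCover`).  No torsion-freeness, no
Borel–Serre bordification, no cellular resolution.

## References

* A. Borel, J.-P. Serre, *Corners and arithmetic groups*, Comment. Math. Helv. 48 (1973), §11.1,
  Thm. 11.4.4 [BorelSerre1973].
* K. S. Brown, *Cohomology of Groups*, GTM 87 (1982), VII (7.10), VIII §2, VIII.9 Ex. 5
  [Brown1982CohomologyGroups].
* A. Borel, *Introduction aux groupes arithmétiques* (1969), §13, §15 [Borel1969].
-/

noncomputable section

set_option linter.dupNamespace false -- `Summit.Langlands.Langlands` is the mandated namespace (summit = problem)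

open scoped MatrixGroups NumberField Pointwise
open CategoryTheory IsDedekindDomain
open Literature.NumberTheory.Automorphic Literature.AlgebraicTopology.SingularHomology
open Literature.Algebra.Homology

namespace Summit.Langlands.Langlands.Theorems

/-- **Borel–Serre finiteness for Bianchi congruence subgroups** (item stmt-Langlands-15362 of
route SkinnerWilesDefectOne): for `K` imaginary quadratic, `U ≤ GL₂(𝔸_K^∞)` compact open and `A` a
finite `ℤ[Γ_U]`-module, `H^q(Γ_U, A)` is finite for every `q` — by Brown's finiteness criterion in
Čech form applied to the cover of the cone of positive binary Hermitian forms by the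
`Γ_U`-translates of an archimedean Siegel domain (free index set, finitely many orbits of nerve
simplices by reduction theory and Borel's Siegel property, contractible intersections by
convexity). [cite: BorelSerre1973, §11.1, Thm. 11.4.4]
[cite: Brown1982CohomologyGroups, VII (7.10); VIII.9 Example 5] [cite: Borel1969, §13, §15] -/
theorem BianchiCongruenceCohomologyFinite_proof :
    Summit.Langlands.Langlands.Theses.SkinnerWilesDefectOne.BianchiCongruenceCohomologyFinite := by
  intro K _ _ h2 hK U hUo hUc A hA q
  haveI : NumberField.IsTotallyComplex K := hK
  classical
  -- notation
  set θ : GL (Fin 2) K →* GL (Fin 2) ℂ := ImaginaryQuadratic.ratToComplexGL K 2 with hθ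
  have hf_apply : ∀ γ, BigHeckeGLn.globalEmbedding 2 K γ =
      Matrix.GeneralLinearGroup.map (algebraMap K (FiniteAdeleRing (𝓞 K) K)) γ := fun γ => rfl
  -- the fundamental set (reduction theory, archimedean form)
  obtain ⟨c, τ, hc, hτ, Q₀, hQ₀, hcov₀⟩ := exists_fundamentalSet_bianchi K h2
  -- the Siegel domain: relatively open, convex, `= 𝔖 • 1`; Cholesky; stabiliser of `1` is `U(2)`
  obtain ⟨hSo, hSconv, hboxS, hSbox, hsurj, hstab1⟩ :=
    BianchiCone.siegelDomain_isOpen_convex_eq_image c τ hc hτ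
  set S := BianchiCone.siegelDomain c τ with hSdef
  set x₀ : ↥BianchiCone.cone := ⟨1, BianchiCone.one_mem_cone⟩ with hx₀
  have hsmul_coe : ∀ (g : GL (Fin 2) ℂ) (H : ↥BianchiCone.cone),
      ((g • H : ↥BianchiCone.cone) : BianchiCone.Mat) = BianchiCone.act g H := fun g H => rfl
  -- cover data: covering and finitely many orbits of nerve simplices (fundamental set + Siegel
  -- property with bounded finite part, the latter through the absorption lemma)
  have hO := SiegelCover.exists_cover_data_of_fundamentalSet_of_siegelProperty
    (X := ↥BianchiCone.cone) θ (BigHeckeGLn.globalEmbedding 2 K) U hUo hUc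
    (BianchiCone.siegelBox c τ) (unitarySubgroup (GL (Fin 2) ℂ)) x₀
    (fun k hk => Subtype.ext (by rw [hsmul_coe]; exact (hstab1 k).2 hk))
    (fun h hh => (hstab1 h).1 (by
      have := congrArg Subtype.val hh
      rwa [hsmul_coe] at this))
    (fun x => by
      obtain ⟨g, hg⟩ := hsurj x.1 x.2
      exact ⟨g, Subtype.ext (by rw [hsmul_coe]; exact hg)⟩)
    ⟨Q₀, hQ₀, fun g => by
      obtain ⟨γ, hγ, b, hb, k, hk, hgbk⟩ := hcov₀ g
      exact ⟨γ, (hf_apply γ).symm ▸ hγ, b, hb, k, hk, hgbk⟩⟩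
    (fun Q hQ => by
      have h := finite_siegelProperty_bianchi K h2
        (exists_isSiegelSetGL_mul_siegelCone_mul_subset 2 K) c τ hc hτ Q hQ
      refine h.subset ?_
      rintro γ ⟨hγ, b, hb, b', hb', k, hk, hγb⟩
      exact ⟨(hf_apply γ) ▸ hγ, b, hb, b', hb', k, hk, hγb⟩)
  obtain ⟨Q, hQc, hcovX, hfinX⟩ := hO
  -- the free `Γ_U`-set of indices `ι = {γ : γ_f ∈ U · Q}` and the action on the cone through `θ`
  let ι : Type := {γ : GL (Fin 2) K //
    BigHeckeGLn.globalEmbedding 2 K γ ∈ (U : Set (BigHeckeGLn.FiniteAdelicGL 2 K)) * Q}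
  letI instι : MulAction ↥(U.comap (BigHeckeGLn.globalEmbedding 2 K)) ι :=
    { smul := fun g i => ⟨g.1 * i.1, by
        obtain ⟨u, hu, q', hq', huq⟩ := Set.mem_mul.1 i.2
        refine Set.mem_mul.2 ⟨BigHeckeGLn.globalEmbedding 2 K g.1 * u, U.mul_mem g.2 hu, q', hq', ?_⟩
        rw [map_mul, ← huq, mul_assoc]⟩
      one_smul := fun i => Subtype.ext (one_mul _)
      mul_smul := fun g g' i => Subtype.ext (mul_assoc _ _ _) }
  have coe_smul_index : ∀ (g : ↥(U.comap (BigHeckeGLn.globalEmbedding 2 K))) (i : ι),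
      ((g • i : ι) : GL (Fin 2) K) = g.1 * i.1 := fun _ _ => rfl
  letI instX : MulAction ↥(U.comap (BigHeckeGLn.globalEmbedding 2 K)) ↥BianchiCone.cone :=
    MulAction.compHom ↥BianchiCone.cone (θ.comp (U.comap (BigHeckeGLn.globalEmbedding 2 K)).subtype)
  have hΓsmul : ∀ (g : ↥(U.comap (BigHeckeGLn.globalEmbedding 2 K))) (H : ↥BianchiCone.cone),
      ((g • H : ↥BianchiCone.cone) : BianchiCone.Mat) = BianchiCone.act (θ g.1) H := fun g H => rfl
  -- the cover `W i = θ(i) • S(c, τ)` traced on the cone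
  set W : ι → Set ↥BianchiCone.cone :=
    fun i => {H | (H : BianchiCone.Mat) ∈ BianchiCone.act (θ i.1) '' S} with hW
  have hWmem : ∀ (i : ι) (H : ↥BianchiCone.cone),
      H ∈ W i ↔ (H : BianchiCone.Mat) ∈ BianchiCone.act (θ i.1) '' S := fun i H => Iff.rfl
  have hcech : ∀ {m : ℕ} (J : Fin m → ι), cechSet W J =
      {H : ↥BianchiCone.cone | ∀ k, (H : BianchiCone.Mat) ∈ BianchiCone.act (θ (J k).1) '' S} := by
    intro m J
    ext H
    rw [mem_cechSet_iff]
    rfl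
  -- Brown's criterion in Čech form for the free equivariant good cover
  refine finite_groupCohomology_int_of_free_equivariantGoodCover (X := ↥BianchiCone.cone)
    (G := ↥(U.comap (BigHeckeGLn.globalEmbedding 2 K))) (ι := ι) W ?_ ?_ ?_ ?_ ?_ ?_ A hA q
  · -- the cover sets are open in the cone
    intro i
    have h := (BianchiCone.isOpen_contractible_translates (BianchiCone.siegelDomain_subset_cone c τ)
      hSo hSconv (fun _ : Fin 1 => θ i.1)).1
    have he : W i = {H : ↥BianchiCone.cone | ∀ k : Fin 1,
        (H : BianchiCone.Mat) ∈ BianchiCone.act ((fun _ : Fin 1 => θ i.1) k) '' S} := by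
      ext H
      rw [hWmem]
      simp only [Set.mem_setOf_eq, forall_const]
    rw [he]
    exact h
  · -- they cover the cone (fundamental set)
    intro H _
    obtain ⟨γ, hγ, b, hb, hH⟩ := hcovX H
    refine Set.mem_iUnion.2 ⟨⟨γ, hγ⟩, ?_⟩
    rw [hWmem]
    refine ⟨BianchiCone.act b 1, hboxS b hb, ?_⟩
    rw [← hH, hsmul_coe, hsmul_coe]
  · -- non-empty finite intersections are contractible (convexity)
    intro p J hJ
    rw [hcech] at hJ ⊢
    exact (BianchiCone.isOpen_contractible_translates (BianchiCone.siegelDomain_subset_cone c τ)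
      hSo hSconv (fun k => θ (J k).1)).2 hJ
  · -- equivariance `g • W i = W (g • i)`
    intro g i
    ext H
    constructor
    · rintro ⟨H', hH', rfl⟩
      rw [hWmem] at hH'
      obtain ⟨s, hs, hsH'⟩ := hH'
      rw [hWmem, hΓsmul, coe_smul_index, map_mul]
      exact ⟨s, hs, by rw [BianchiCone.act_mul, hsH']⟩
    · intro hH
      rw [hWmem, coe_smul_index, map_mul] at hH
      obtain ⟨s, hs, hsH⟩ := hH
      refine ⟨g⁻¹ • H, ?_, smul_inv_smul g H⟩
      rw [hWmem, hΓsmul]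
      refine ⟨s, hs, ?_⟩
      rw [← hsH, ← BianchiCone.act_mul, Subgroup.coe_inv, map_inv, inv_mul_cancel_left]
  · -- the action on indices is free
    intro g i hgi
    have h := congrArg Subtype.val hgi
    rw [coe_smul_index] at h
    exact Subtype.ext (mul_eq_right.1 h |>.symm ▸ rfl)
  · -- finitely many orbits of nerve simplices (Siegel property)
    intro p
    obtain ⟨S₀, hS₀, hrep⟩ := hfinX p
    refine ⟨{J₀ : Fin (p + 1) → ι | (fun k => (J₀ k).1) ∈ S₀}, ?_, ?_⟩
    · refine hS₀.preimage ?_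
      intro J₁ _ J₂ _ hJ
      funext k
      exact Subtype.ext (congrFun hJ k)
    · intro J hJ
      rw [hcech] at hJ
      obtain ⟨H, hH⟩ := hJ
      have hx : ∃ x : ↥BianchiCone.cone, ∀ k, ∃ b ∈ BianchiCone.siegelBox c τ,
          θ (J k).1 • b • x₀ = x := by
        refine ⟨H, fun k => ?_⟩
        obtain ⟨s, hs, hsH⟩ := hH k
        obtain ⟨b, hb, hbs⟩ := hSbox s hs
        refine ⟨b, hb, Subtype.ext ?_⟩
        rw [hsmul_coe, hsmul_coe, ← hsH, ← hbs]
      obtain ⟨J₀, hJ₀, g, hg, hgJ⟩ := hrep (fun k => (J k).1) (fun k => (J k).2) hx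
      have hmem : ∀ k, BigHeckeGLn.globalEmbedding 2 K (J₀ k) ∈
          (U : Set (BigHeckeGLn.FiniteAdelicGL 2 K)) * Q := by
        intro k
        obtain ⟨u, hu, q', hq', huq⟩ := Set.mem_mul.1 (J k).2
        refine Set.mem_mul.2 ⟨(BigHeckeGLn.globalEmbedding 2 K g)⁻¹ * u, U.mul_mem (U.inv_mem hg) hu,
          q', hq', ?_⟩
        have hk : J₀ k = g⁻¹ * (J k).1 := by rw [← hgJ k, inv_mul_cancel_left]
        rw [hk, map_mul, map_inv, mul_assoc, huq]
      refine ⟨fun k => ⟨J₀ k, hmem k⟩, hJ₀, ⟨g, hg⟩, ?_⟩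
      funext k
      exact Subtype.ext (hgJ k)

end Summit.Langlands.Langlands.Theorems
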